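import Literature.Computability.Complexity.ResourceBoundedMeasureFacts
import Literature.Computability.Complexity.CodeFPRat
import HarnessLib

/-!
# Resource-bounded (Lutz) measure V: proof of the E-uniform union lemma (`pMeasureZero_iUnion`)

Discharge `pMeasureZero_iUnion_holds` of the named fact `pMeasureZero_iUnion` of
`ResourceBoundedMeasureFacts.lean` (a sibling of the discharges of measure conservation,
`ResourceBoundedMeasureFactsProofs.lean`, and of `DTIME[2^{cn}]`,
`ResourceBoundedMeasureDTIMEProofs.lean`) — van Melkebeek's Thm. 2.5.2: *if `(d_i)_i` is an
E-uniform system of martingales and `d_i` covers `C_i`, then `⋃_i C_i` has E-measure (here: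
`p`-measure) zero*. Van Melkebeek states the theorem without proof, crediting Lutz [88]
(= [Lutz1992]); the proof formalised here is the standard exact-computation argument ("restart
`d_i` at length `i`"), which keeps every value an exact rational, so that Def. 2.5.1 is met
literally:

* `UnionLemma.restart ds i` — the **conditional restart** of `d_i` at length `i`: capital `1` on
  strings of length `≤ i`, afterwards the bets of `d_i` rescaled by the capital `d_i(w ↾ i)` it had
  on the length-`i` prefix (and `1` for ever if that capital is `0`). It is a martingale
  (`restart_isMartingale`) succeeding wherever `d_i` does (`succeedsOn_restart`: a martingale that
  is bankrupt on `χ_L ↾ i` stays bankrupt along `χ_L`, so success forces `d_i(χ_L ↾ i) > 0`).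
* `UnionLemma.unionMG ds w = Σ_{i<|w|} restart_i(w) / 2^{i+1} + 2^{-|w|}` — the **union
  martingale**; since `restart_i(w) = 1` for `i ≥ |w|` this IS `Σ_i restart_i(w)/2^{i+1}`, the
  tail being the geometric series `Σ_{i ≥ |w|} 2^{-(i+1)} = 2^{-|w|}` (`sumPart_add_inv_two_pow`),
  whence the average law (`unionMG_isMartingale`); and `unionMG ≥ restart_i / 2^{i+1}` gives
  success on every `S^∞[d_i]` (`succeedsOn_unionMG`).
* `p`-computability (`unionMG_isPComputable`) is assembled in the typed `CodeFP` algebra with no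
  machine written: an E-uniform system is computed on codes by a TOTAL polynomial-time function
  (`IsEUniform.codeFP`: sanitise any string to a genuine code `⟨1^{|fstF z|}, sndF z⟩`, then run the
  system's machine, `PolyTimeComputable.comp_holds`); the `|w|` summands are a `CodeFP.map` over the
  unary index list, added exactly by `CodeFP.ratSum` (`CodeFPRat.lean`); the value code of
  `IsPComputable` is literally `encodeRat` (`isPComputable_of_codeFP`).

## References

* D. van Melkebeek, *Randomness and Completeness in Computational Complexity*, LNCS 1950 (2000),
  §2.5.3, Thm. 2.5.2 (p. 50) [VanMelkebeek2000].
* J. H. Lutz, *Almost everywhere high nonuniform complexity*, JCSS 44 (1992) 220–258 [Lutz1992]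
  (the source credited by van Melkebeek; not consulted for this file).
* S. Arora, B. Barak, *Computational Complexity: A Modern Approach*, CUP 2009, §1.3
  [AroraBarak2009].
-/

namespace Literature.Computability.Complexity

open _root_.Computability

namespace UnionLemma

variable (ds : ℕ → List Bool → ℚ)

/-- The **conditional restart** of `d_i` at length `i`:
`restart_i(w) = d_i(w) / d_i(w ↾ i)` if `d_i(w ↾ i) ≠ 0` and `1` otherwise (so `= 1` whenever
`|w| ≤ i`, `restart_of_length_le`: the length test of the informal definition is redundant).
[cite: VanMelkebeek2000, Thm. 2.5.2 p. 50] -/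
def restart (i : ℕ) (w : List Bool) : ℚ :=
  if ds i (w.take i) = 0 then 1 else ds i w / ds i (w.take i)

/-- The `i`-th weighted summand `restart_i(w) / 2^{i+1}` of the union martingale. [folklore] -/
def term (i : ℕ) (w : List Bool) : ℚ := restart ds i w / 2 ^ (i + 1)

/-- The partial sums `Σ_{i<M} restart_i(w) / 2^{i+1}` (a list sum, the shape computed on codes).
[folklore] -/
def sumPart (M : ℕ) (w : List Bool) : ℚ := ((List.range M).map fun i => term ds i w).sum

/-- **The union martingale** `d(w) = Σ_{i<|w|} restart_i(w) / 2^{i+1} + 2^{-|w|}`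
(`= Σ_i restart_i(w) / 2^{i+1}`, the tail `i ≥ |w|` being geometric).
[cite: VanMelkebeek2000, Thm. 2.5.2 p. 50] -/
def unionMG (w : List Bool) : ℚ := sumPart ds w.length w + 1 / 2 ^ w.length

variable {ds}

/-! ### The restarted martingales -/

/-- Up to length `i` the restart has capital `1`. [folklore] -/
theorem restart_of_length_le {i : ℕ} {w : List Bool} (h : w.length ≤ i) : restart ds i w = 1 := by
  unfold restart
  rw [List.take_of_length_le h]
  split_ifs with hz
  · rfl
  · exact div_self hz

/-- The restart of a nonnegative function is nonnegative. [folklore] -/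
theorem restart_nonneg {i : ℕ} (h : ∀ w, 0 ≤ ds i w) (w : List Bool) : 0 ≤ restart ds i w := by
  unfold restart
  split_ifs
  · exact zero_le_one
  · exact div_nonneg (h _) (h _)

/-- The restart of a martingale satisfies the average law. [cite: VanMelkebeek2000, §2.5.2 (2.3)] -/
theorem restart_avg {i : ℕ} (hd : IsMartingale (ds i)) (w : List Bool) :
    restart ds i (w ++ [false]) + restart ds i (w ++ [true]) = 2 * restart ds i w := by
  rcases lt_or_ge w.length i with hlt | hge
  · -- short `w`: all three strings are no longer than `i`
    rw [restart_of_length_le hlt.le, restart_of_length_le (by simp; omega),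
      restart_of_length_le (by simp; omega)]
    norm_num
  · -- `|w| ≥ i`: both extensions have the same length-`i` prefix as `w`
    have ht : ∀ b, (w ++ [b]).take i = w.take i := fun b => List.take_append_of_le_length hge
    unfold restart
    rw [ht, ht]
    by_cases hz : ds i (w.take i) = 0
    · simp only [if_pos hz]
      norm_num
    · simp only [if_neg hz]
      rw [← add_div, hd.avg, mul_div_assoc]

/-- **The restart of a martingale is a martingale.** [cite: VanMelkebeek2000, Thm. 2.5.2 p. 50] -/
theorem restart_isMartingale {i : ℕ} (hd : IsMartingale (ds i)) : IsMartingale (restart ds i) :=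
  ⟨restart_nonneg hd.nonneg, restart_avg hd⟩

/-- The summands are nonnegative. [folklore] -/
theorem term_nonneg {i : ℕ} (h : ∀ w, 0 ≤ ds i w) (w : List Bool) : 0 ≤ term ds i w :=
  div_nonneg (restart_nonneg h w) (by positivity)

/-- The summands satisfy the average law. [folklore] -/
theorem term_avg {i : ℕ} (hd : IsMartingale (ds i)) (w : List Bool) :
    term ds i (w ++ [false]) + term ds i (w ++ [true]) = 2 * term ds i w := by
  unfold term
  rw [← add_div, restart_avg hd, mul_div_assoc]

/-- Up to length `i` the `i`-th summand is the constant `2^{-(i+1)}`. [folklore] -/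
theorem term_of_length_le {i : ℕ} {w : List Bool} (h : w.length ≤ i) :
    term ds i w = 1 / 2 ^ (i + 1) := by
  rw [term, restart_of_length_le h]

/-! ### The union martingale -/

/-- One more summand. [folklore] -/
theorem sumPart_succ (M : ℕ) (w : List Bool) :
    sumPart ds (M + 1) w = sumPart ds M w + term ds M w := by
  unfold sumPart
  rw [List.sum_range_succ]

/-- Partial sums are nonnegative. [folklore] -/
theorem sumPart_nonneg (h : ∀ i w, 0 ≤ ds i w) (M : ℕ) (w : List Bool) : 0 ≤ sumPart ds M w := by
  induction M with
  | zero => simp [sumPart]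
  | succ M ih => rw [sumPart_succ]; exact add_nonneg ih (term_nonneg (h M) w)

/-- Partial sums (for a FIXED number of summands) satisfy the average law. [folklore] -/
theorem sumPart_avg (h : ∀ i, IsMartingale (ds i)) (M : ℕ) (w : List Bool) :
    sumPart ds M (w ++ [false]) + sumPart ds M (w ++ [true]) = 2 * sumPart ds M w := by
  induction M with
  | zero => simp [sumPart]
  | succ M ih =>
    rw [sumPart_succ, sumPart_succ, sumPart_succ]
    have := term_avg (h M) w
    linarith

/-- A summand is at most the partial sum. [folklore] -/
theorem term_le_sumPart (h : ∀ i w, 0 ≤ ds i w) {i M : ℕ} (hi : i < M) (w : List Bool) :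
    term ds i w ≤ sumPart ds M w := by
  unfold sumPart
  refine List.single_le_sum (fun x hx => ?_) _ (List.mem_map.2 ⟨i, List.mem_range.2 hi, rfl⟩)
  obtain ⟨j, -, rfl⟩ := List.mem_map.1 hx
  exact term_nonneg (h j) w

/-- **The geometric tail**: past the length of `w` one more summand does not change
`sumPart M w + 2^{-M}`, so this is `unionMG w` for every `M ≥ |w|`. [folklore] -/
theorem sumPart_add_inv_two_pow {M : ℕ} {w : List Bool} (hM : w.length ≤ M) :
    sumPart ds M w + 1 / 2 ^ M = unionMG ds w := by
  induction M, hM using Nat.le_induction with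
  | base => rfl
  | succ M hM ih =>
    rw [← ih, sumPart_succ, term_of_length_le hM, pow_succ]
    have h2 : (2 : ℚ) ^ M ≠ 0 := pow_ne_zero _ two_ne_zero
    field_simp
    ring

/-- The union martingale is nonnegative. [folklore] -/
theorem unionMG_nonneg (h : ∀ i w, 0 ≤ ds i w) (w : List Bool) : 0 ≤ unionMG ds w :=
  add_nonneg (sumPart_nonneg h _ w) (by positivity)

/-- The union martingale satisfies the average law (compare `d(w0)`, `d(w1)` and `d(w)` as sums
with the same number `|w| + 1` of summands). [cite: VanMelkebeek2000, §2.5.2 (2.3)] -/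
theorem unionMG_avg (h : ∀ i, IsMartingale (ds i)) (w : List Bool) :
    unionMG ds (w ++ [false]) + unionMG ds (w ++ [true]) = 2 * unionMG ds w := by
  rw [← sumPart_add_inv_two_pow (M := w.length + 1) (Nat.le_add_right w.length 1)]
  unfold unionMG
  simp only [List.length_append, List.length_singleton]
  have := sumPart_avg h (w.length + 1) w
  linarith

/-- **The union martingale of a system of martingales is a martingale.**
[cite: VanMelkebeek2000, Thm. 2.5.2 p. 50] -/
theorem unionMG_isMartingale (h : ∀ i, IsMartingale (ds i)) : IsMartingale (unionMG ds) :=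
  ⟨unionMG_nonneg fun i => (h i).nonneg, unionMG_avg h⟩

/-- `restart_i(w) / 2^{i+1} ≤ d(w)` once `i < |w|`. [folklore] -/
theorem term_le_unionMG (h : ∀ i w, 0 ≤ ds i w) {i : ℕ} {w : List Bool} (hi : i < w.length) :
    term ds i w ≤ unionMG ds w :=
  (term_le_sumPart h hi w).trans (le_add_of_nonneg_right (by positivity))

/-! ### Success sets -/

/-- A martingale grows at most geometrically along a characteristic sequence:
`d(χ_L ↾ N) ≤ 2^N d(λ)`. [cite: VanMelkebeek2000, §2.5.2] -/
theorem _root_.Literature.Computability.Complexity.IsMartingale.apply_charPrefix_le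
    {d : List Bool → ℚ} (hd : IsMartingale d) (L : Language Bool) :
    ∀ N, d (charPrefix L N) ≤ 2 ^ N * d []
  | 0 => by rw [List.eq_nil_of_length_eq_zero (length_charPrefix L 0)]; simp
  | N + 1 => by
    rw [charPrefix_succ]
    calc d (charPrefix L N ++ _) ≤ 2 * d (charPrefix L N) := hd.apply_append_le _ _
      _ ≤ 2 * (2 ^ N * d []) :=
          mul_le_mul_of_nonneg_left (IsMartingale.apply_charPrefix_le hd L N) zero_le_two
      _ = 2 ^ (N + 1) * d [] := by ring

/-- Once bankrupt along a characteristic sequence, a martingale stays bankrupt.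
[cite: VanMelkebeek2000, §2.5.2] -/
theorem _root_.Literature.Computability.Complexity.IsMartingale.apply_charPrefix_eq_zero
    {d : List Bool → ℚ} (hd : IsMartingale d) {L : Language Bool} {i : ℕ}
    (h0 : d (charPrefix L i) = 0) {N : ℕ} (hN : i ≤ N) : d (charPrefix L N) = 0 := by
  induction N, hN using Nat.le_induction with
  | base => exact h0
  | succ N hN ih =>
    rw [charPrefix_succ]
    refine le_antisymm ((hd.apply_append_le _ _).trans ?_) (hd.nonneg _)
    rw [ih]
    norm_num

/-- Prefixes of characteristic prefixes: `(χ_L ↾ N) ↾ i = χ_L ↾ i` for `i ≤ N`. [folklore] -/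
theorem _root_.Literature.Computability.Complexity.charPrefix_take (L : Language Bool) {i N : ℕ}
    (h : i ≤ N) : (charPrefix L N).take i = charPrefix L i := by
  unfold charPrefix
  rw [← List.map_take, List.take_range, min_eq_left h]

/-- **The restart of `d_i` succeeds wherever `d_i` does**: success of `d_i` on `L` forces
`d_i(χ_L ↾ i) > 0` (a bankrupt martingale stays bankrupt, and before length `i` the capital is at
most `2^i d_i(λ)`), and then `restart_i = d_i / d_i(χ_L ↾ i)` along `χ_L` past length `i`.
[cite: VanMelkebeek2000, Thm. 2.5.2 p. 50] -/
theorem succeedsOn_restart {i : ℕ} (hd : IsMartingale (ds i)) {L : Language Bool}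
    (hs : SucceedsOn (ds i) L) : SucceedsOn (restart ds i) L := by
  have hbnd : ∀ N, N ≤ i → ds i (charPrefix L N) ≤ 2 ^ i * ds i [] := fun N hN =>
    (hd.apply_charPrefix_le L N).trans
      (mul_le_mul_of_nonneg_right (pow_le_pow_right₀ one_le_two hN) (hd.nonneg _))
  have hc₀ := Nat.le_ceil (2 ^ i * ds i [])
  by_cases hu : ds i (charPrefix L i) = 0
  · exfalso
    obtain ⟨N, hN⟩ := hs ⌈2 ^ i * ds i []⌉₊
    rcases le_or_gt N i with hNi | hNi
    · have := hbnd N hNi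
      linarith
    · rw [hd.apply_charPrefix_eq_zero hu hNi.le] at hN
      have : (0 : ℚ) ≤ ⌈2 ^ i * ds i []⌉₊ := Nat.cast_nonneg _
      linarith
  · have hpos : 0 < ds i (charPrefix L i) := lt_of_le_of_ne (hd.nonneg _) (Ne.symm hu)
    intro c
    obtain ⟨N, hN⟩ := hs (⌈(c : ℚ) * ds i (charPrefix L i)⌉₊ + ⌈2 ^ i * ds i []⌉₊)
    push_cast at hN
    have hc₁ := Nat.le_ceil ((c : ℚ) * ds i (charPrefix L i))
    have h0₁ : (0 : ℚ) ≤ ⌈(c : ℚ) * ds i (charPrefix L i)⌉₊ := Nat.cast_nonneg _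
    have h0₂ : (0 : ℚ) ≤ ⌈2 ^ i * ds i []⌉₊ := Nat.cast_nonneg _
    have hNi : i < N := by
      by_contra hle
      have := hbnd N (not_lt.1 hle)
      linarith
    refine ⟨N, ?_⟩
    rw [restart, charPrefix_take L hNi.le, if_neg hu, lt_div_iff₀ hpos]
    linarith

/-- **The union martingale succeeds wherever some restart does** (`d ≥ restart_i / 2^{i+1}` past
length `i`, and a capital `> 2^{i+1} c + 1 ≥ 1` of `restart_i` can only occur past length `i`).
[cite: VanMelkebeek2000, Thm. 2.5.2 p. 50] -/
theorem succeedsOn_unionMG (h : ∀ i w, 0 ≤ ds i w) {i : ℕ} {L : Language Bool}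
    (hs : SucceedsOn (restart ds i) L) : SucceedsOn (unionMG ds) L := by
  intro c
  obtain ⟨N, hN⟩ := hs (2 ^ (i + 1) * c + 1)
  have hiN : i < N := by
    by_contra hle
    rw [restart_of_length_le (by simpa using not_lt.1 hle)] at hN
    have : (1 : ℚ) ≤ ((2 ^ (i + 1) * c + 1 : ℕ) : ℚ) := by exact_mod_cast Nat.le_add_left 1 _
    linarith
  refine ⟨N, ?_⟩
  have h2 : (0 : ℚ) < 2 ^ (i + 1) := by positivity
  calc (c : ℚ) < ((2 ^ (i + 1) * c + 1 : ℕ) : ℚ) / 2 ^ (i + 1) := by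
        rw [lt_div_iff₀ h2]; push_cast; linarith
    _ < restart ds i (charPrefix L N) / 2 ^ (i + 1) := div_lt_div_of_pos_right hN h2
    _ ≤ unionMG ds (charPrefix L N) := term_le_unionMG h (by simpa using hiN)

end UnionLemma

/-! ### E-uniform systems on codes; the union martingale is `p`-computable -/

open CodeFP Brick
open Literature.Algebra.EuclideanLattices (encodeRat)

/-- **`IsPComputable` from a computation on codes**: the value code of `IsPComputable` is
`encodeRat` (`(num, den)` through `encodingIntBool.pairBool encodingNatBool`), so a
`CodeFP strE encodeRat d` datum is literally the required machine. [folklore] -/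
theorem isPComputable_of_codeFP {d : List Bool → ℚ} (h : CodeFP strE encodeRat d) :
    IsPComputable d := by
  obtain ⟨f, hf, hfd⟩ := h
  obtain rfl : f = fun w => encodeRat (d w) := funext hfd
  exact hf

/-- **An E-uniform system is computed on codes** by a TOTAL polynomial-time string function:
sanitise any string `z` to the genuine code `⟨1^{|fstF z|}, sndF z⟩` (the identity on codes), then
run the machine of the system (`PolyTimeComputable.comp_holds`; cf. `mem_FP_of_unaryArg`).
[cite: AroraBarak2009, §1.3] -/
theorem IsEUniform.codeFP {ds : ℕ → List Bool → ℚ} (h : IsEUniform ds) :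
    CodeFP (pairE unE strE) encodeRat (fun p => ds p.1 p.2) := by
  have hg : PolyTimeComputable (id : List Bool → List Bool)
      (fun p : ℕ × List Bool => boolPair (unaryEncodeNat p.1) p.2)
      (fun z => ((fstF z).length, sndF z)) := by
    obtain ⟨p, M, hM⟩ := fanoutFn_mem_FP (comp_mem_FP onesFn_mem_FP fstF_mem_FP) sndF_mem_FP
    refine ⟨p, M, fun z => ?_⟩
    have h := hM z
    rw [id, fanoutFn_apply, Function.comp_apply, onesFn] at h
    exact h
  obtain ⟨p, M, hM⟩ := PolyTimeComputable.comp_holds h hg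
  refine ⟨fun z => encodeRat (ds (fstF z).length (sndF z)), ⟨p, M, fun z => hM z⟩, fun q => ?_⟩
  show encodeRat (ds (fstF (boolPair (unE q.1) q.2)).length (sndF (boolPair (unE q.1) q.2))) =
    encodeRat (ds q.1 q.2)
  rw [fstF_boolPair, sndF_boolPair, length_unE]

namespace UnionLemma

variable {ds : ℕ → List Bool → ℚ}

/-- The summands `restart_i(w) / 2^{i+1}` on codes `⟨w, 1^i⟩`: two calls of the E-uniform machine
(on `w` and on `w ↾ i`), a zero test, an exact division, and the power `2^{i+1}` from the unary `i`.
[cite: VanMelkebeek2000, Thm. 2.5.2 p. 50] -/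
theorem term_codeFP (h : IsEUniform ds) :
    CodeFP (pairE strE unE) encodeRat (fun t => term ds t.2 t.1) := by
  have hE := h.codeFP
  have hw : CodeFP (pairE strE unE) strE Prod.fst := fst _ _
  have hi : CodeFP (pairE strE unE) unE Prod.snd := snd _ _
  have ha : CodeFP (pairE strE unE) encodeRat (fun t => ds t.2 t.1) := (hE.comp (hi.pair hw) :)
  have hu : CodeFP (pairE strE unE) strE (fun t => t.1.take t.2) := (strTake.comp (hi.pair hw) :)
  have hb : CodeFP (pairE strE unE) encodeRat (fun t => ds t.2 (t.1.take t.2)) :=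
    (hE.comp (hi.pair hu) :)
  have hz : CodeFP (pairE strE unE) bitE (fun t => decide (ds t.2 (t.1.take t.2) = 0)) :=
    (ratEq.comp (hb.pair (const _ (0 : ℚ))) :)
  have hR : CodeFP (pairE strE unE) encodeRat (fun t => restart ds t.2 t.1) :=
    (hz.ite (const _ (1 : ℚ)) (ratDiv.comp (ha.pair hb))).congr fun t => by
      simp only [restart, decide_eq_true_eq]
  have hp : CodeFP (pairE strE unE) encodeRat (fun t => (2 : ℚ) ^ (t.2 + 1)) :=
    (ratOfIntNat.comp ((intOfNat.comp (natPow.comp ((const _ 2).pair (unSucc.comp hi)))).pair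
      (const _ 1))).congr fun t => by
        show (((2 ^ (t.2 + 1) : ℕ) : ℤ) : ℚ) / ((1 : ℕ) : ℚ) = 2 ^ (t.2 + 1)
        push_cast
        rw [div_one]
  refine (ratDiv.comp (hR.pair hp)).congr fun t => ?_
  rfl

/-- The index list `[1^0, …, 1^{|w|-1}]` from `w` (binary range of the unary length, converted
back to unary under the budget `|w|`). [folklore] -/
theorem range_codeFP : CodeFP strE (rawE unE) (fun w => List.range w.length) := by
  have hm := map (σ := ℕ) (eσ := unE) (α := ℕ) (eα := natE) (eβ := unE)
    (g := fun q : ℕ × ℕ => min q.2 q.1) unOfNatMin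
  refine ((hm.comp (strLength.pair (urange.comp strLength))).congr fun w => ?_)
  show (List.range w.length).map (fun a => min a w.length) = List.range w.length
  exact (List.map_congr_left fun a ha =>
    (min_eq_left (List.mem_range.1 ha).le : min a w.length = id a)).trans (List.map_id _)

/-- **The union martingale is computed on codes**: list the indices `i < |w|`, compute each
summand through the E-uniform machine (`CodeFP.map` with context `w`), add the list exactly
(`CodeFP.ratSum`), add the tail `2^{-|w|}`. [cite: VanMelkebeek2000, Thm. 2.5.2 p. 50] -/
theorem unionMG_codeFP (h : IsEUniform ds) : CodeFP strE encodeRat (unionMG ds) := by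
  have hterms : CodeFP strE (rawE encodeRat)
      (fun w => (List.range w.length).map fun i => term ds i w) :=
    ((map (term_codeFP h)).comp ((CodeFP.id strE).pair range_codeFP) :)
  have hsum : CodeFP strE encodeRat (fun w => sumPart ds w.length w) := (ratSum.comp hterms :)
  have htail : CodeFP strE encodeRat (fun w => (1 : ℚ) / 2 ^ w.length) :=
    (ratOfIntNat.comp ((const _ (1 : ℤ)).pair (natPow.comp ((const _ 2).pair strLength)))).congr
      fun w => by
        show ((1 : ℤ) : ℚ) / ((2 ^ w.length : ℕ) : ℚ) = 1 / 2 ^ w.length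
        push_cast
        rfl
  exact (ratAdd.comp (hsum.pair htail) :)

/-- **The union martingale of an E-uniform system is `p`-computable.**
[cite: VanMelkebeek2000, Thm. 2.5.2 p. 50] -/
theorem unionMG_isPComputable (h : IsEUniform ds) : IsPComputable (unionMG ds) :=
  isPComputable_of_codeFP (unionMG_codeFP h)

end UnionLemma

/-! ### The theorem -/

open UnionLemma in
/-- **Lutz's E-uniform union lemma holds** (discharge of the named fact `pMeasureZero_iUnion`,
van Melkebeek's Thm. 2.5.2): for an E-uniform system `(d_i)_i` of martingales, the union
martingale `Σ_i restart_i / 2^{i+1}` is ONE `p`-computable martingale succeeding on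
`⋃_i S^∞[d_i] ⊇ ⋃_i C_i`, so `μ_p(⋃_i C_i) = 0`. [cite: VanMelkebeek2000, Thm. 2.5.2 p. 50] -/
theorem pMeasureZero_iUnion_holds : pMeasureZero_iUnion := by
  intro ds C hmart hunif hcov
  rw [pMeasureZero_iff]
  refine ⟨unionMG ds, unionMG_isMartingale hmart, unionMG_isPComputable hunif, fun L hL => ?_⟩
  obtain ⟨i, hi⟩ := Set.mem_iUnion.1 hL
  exact succeedsOn_unionMG (fun j => (hmart j).nonneg) (succeedsOn_restart (hmart i) (hcov i hi))

end Literature.Computability.Complexity
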